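import Summits.HodgeConjecture.HodgeConjecture.Theorems.F0P3cStCharTSLevelFamily     -- ★ p849745 (this seat): the pinned (SHF′) chain (`Ω := hyperbolicSet`), levels of an Iwahori datum
import Summits.HodgeConjecture.HodgeConjecture.Theorems.F0P3cStCharTSHTwoOfPsi       -- ★ p849878 (this seat): `hshell` from the producer `Ψ` (pinned)
import HarnessLib

/-!
# F0 · P3c · line LH6 «StCharTS» — «Ω-CUT★» of the (SHF′) ∕ «SURJ-HECKE★» chain: the support set `Ω` as a PARAMETER
# (for the integrator's (SHF′°) on the trace-open core `Ω° = {γ | 1 < |(tr γ)_w|_w}`) [Rogawski1990, §12.7 L. 12.7.1–12.7.2 (proofs) pp. 191–194]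

Cell `pub/hodgecm-mathlib`, crux H413 = `stmt-HodgeConjecture-24833` (`--supports`, helper lane), route HCCMUnconditional; seat LH6-p05 (g2); answers the (TOR)-road
integrator LH6-p01 (g3)'s 2026-09-02T07:12:39Z ask («does your SURJ road deliver `tsupport φ ⊆ Ω°`?» — road «W», (W-A) «Ω° CUT», (SHF′°)).  THEOREMS ONLY.
THE POINT.  The base theorems of the chain are ALREADY generic in the support set (★ `F0P3cStCharTSShfOfSurj.shf_of_surj` and ★ `F0P3cStCharTSSurjHecke.surj_of_shells`
take `Ω : Set (Gqs L v)`); only the named-term tops pinned `Ω := hyperbolicSet L v` (★ `…SurjHeckeLin.surj∕shf_torusTransform_of_shells`, ★ `…LevelFamily.surj∕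
shf_torusTransform_of_levelShells`, ★ `…HShellGlue.hshell_of_twoCoset`, ★ `…HTwoOfPsi.hshell_of_psi`).  Their proofs use NO property of `hyperbolicSet` (the set only
rides in the `tsupport φ ⊆ Ω` clause of `hshell` and of the produced test functions), so here are the SAME six theorems with `Ω` a binder (`…_on`, texts otherwise
VERBATIM, proofs the ★ ones re-pointed): instantiate `Ω := hyperbolicSet L v` to recover the ★ tops, or `Ω := {γ | 1 < Valued.v ((Matrix.trace (γ.val : Matrix …)) w)}`
(the trace-open core `Ω°`, ★ `F0P3cStCharTSHyperbolicCore`) for (SHF′°): the Hecke shells `K_n·ι(u)·K_n` at dominant `u` lie in `Ω°` (★ (H2g)), so the `hshell` producer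
delivers `tsupport ⊆ Ω°` and this chain returns (SHF′°) VERBATIM-shaped.
* `surj_torusTransform_of_shells_on`, `shf_torusTransform_of_shells_on` (★ p849718 tops, `Ω` generic);
* `surj_torusTransform_of_levelShells_on`, **`shf_torusTransform_of_levelShells_on`** (★ p849745 tops, `Ω` generic: (SHF′) at `torusTransform ∕ Ω ∕ pairChar` from `hshell` on `Ω`);
* `hshell_of_twoCoset_on`, **`hshell_of_psi_on`** (★ p849770 ∕ p849878, `Ω` generic).
HONEST LABEL: count-neutral re-instantiation; HC_CM is proved only modulo the 7 printed citations (2 remaining: hLiu418 = stmt-HodgeConjecture-24832, h413 =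
stmt-HodgeConjecture-24833) until rung 0 closes.

## References
* [Rogawski1990] J. D. Rogawski, *Automorphic Representations of Unitary Groups in Three Variables*, Ann. of Math. Stud. 123 (1990): §12.7 L. 12.7.1 (proof) p. 191,
  L. 12.7.2 (proof) pp. 193–194; §12.2 p. 173.
* [Casselman1995] W. Casselman, *Introduction to the theory of admissible representations of p-adic reductive groups* (1995 notes): §1.4 Prop. 1.4.4 p. 14.
-/

set_option autoImplicit false
-- the mandated namespace has the single-problem summit's repeated segment (`HodgeConjecture.HodgeConjecture`)
set_option linter.dupNamespace false

noncomputable section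

open NumberField IsDedekindDomain MeasureTheory Measure Topology Filter
open scoped NNReal ENNReal Pointwise MatrixGroups
open Literature.NumberTheory.Rogawski1990 Literature.NumberTheory.Automorphic Literature.NumberTheory.Automorphic.UnitaryGroup
open Summit.HodgeConjecture.HodgeConjecture.Cruxes.H413

namespace Summit.HodgeConjecture.HodgeConjecture.Cruxes.H413.F0P3cStCharTSSurjOmega

variable (L : Type) [Field L] [NumberField L] [IsCMField L] (v : HeightOneSpectrum (𝓞 ↥(maximalRealSubfield L)))

/-- **(SURJ) FOR `torusTransform` ∕ `hyperbolicSet` MODULO THE SHELL TRANSFORMS** — ★ p849667 `surj_of_shells` with `hlin` discharged by §2.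
[cite: Rogawski1990, §12.7 L. 12.7.1 (proof) p. 191; L. 12.7.2 (proof) p. 194] -/
theorem surj_torusTransform_of_shells_on (hns : ∀ w : PlacesOver L v, IsCMField.complexConj L • w.1 = w.1) (Ω : Set (Gqs L v))
    [MeasurableSpace (Gqs L v)] [BorelSpace (Gqs L v)]
    [∀ γ : Gqs L v, MeasurableSpace (Gqs L v ⧸ Subgroup.centralizer ({γ} : Set (Gqs L v)))]
    [∀ γ : Gqs L v, BorelSpace (Gqs L v ⧸ Subgroup.centralizer ({γ} : Set (Gqs L v)))]
    (νQv : Measure (Gqs L v)) [νQv.IsHaarMeasure] [νQv.IsMulRightInvariant]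
    {mQv : OrbitalMeasureFamily (Gqs L v)} (hcanQ : mQv.IsCanonical (fun γ => IsRegularElt (γ.val : GL (Fin 3) (UnitaryGroup.LocalRing L v))) νQv)
    [MeasurableSpace ((UnitaryGroup.LocalRing L v)ˣ × ↥(normOneUnits (conjLocal L (IsCMField.complexConj L) v)))] (μM : Measure ((UnitaryGroup.LocalRing L v)ˣ × ↥(normOneUnits (conjLocal L (IsCMField.complexConj L) v))))
    (C : ℕ → Subgroup ((UnitaryGroup.LocalRing L v)ˣ × ↥(normOneUnits (conjLocal L (IsCMField.complexConj L) v)))) (hCo : ∀ n, IsOpen (C n : Set ((UnitaryGroup.LocalRing L v)ˣ × ↥(normOneUnits (conjLocal L (IsCMField.complexConj L) v)))))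
    (hCle : ∀ n, C n ≤ (((Submonoid.pi Set.univ (fun w : PlacesOver L v => (w.1.adicCompletionIntegers L).toSubring.toSubmonoid)).units.prod (⊤ : Subgroup ↥(normOneUnits (conjLocal L (IsCMField.complexConj L) v)))) : Subgroup ((UnitaryGroup.LocalRing L v)ˣ × ↥(normOneUnits (conjLocal L (IsCMField.complexConj L) v))))) (hCb : ∀ V ∈ 𝓝 (1 : ((UnitaryGroup.LocalRing L v)ˣ × ↥(normOneUnits (conjLocal L (IsCMField.complexConj L) v)))), ∃ n, (C n : Set ((UnitaryGroup.LocalRing L v)ˣ × ↥(normOneUnits (conjLocal L (IsCMField.complexConj L) v)))) ⊆ V)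
    (hshell : ∀ (n : ℕ) (u : ((UnitaryGroup.LocalRing L v)ˣ × ↥(normOneUnits (conjLocal L (IsCMField.complexConj L) v)))), (∀ w : PlacesOver L v, Valued.v ((u.1 : UnitaryGroup.LocalRing L v) w) < 1) →
      ∃ φ : Gqs L v → ℂ, IsLocSmooth φ ∧ tsupport φ ⊆ Ω ∧ ∃ κ : ℂ, κ ≠ 0 ∧
        F0P3cStCharTSTorusDefs.torusTransform L v mQv μM φ =
          fun m => κ * ((u • (C n : Set ((UnitaryGroup.LocalRing L v)ˣ × ↥(normOneUnits (conjLocal L (IsCMField.complexConj L) v))))).indicator (fun _ => (1 : ℂ)) m + (u • (C n : Set ((UnitaryGroup.LocalRing L v)ˣ × ↥(normOneUnits (conjLocal L (IsCMField.complexConj L) v))))).indicator (fun _ => (1 : ℂ)) ((fun p : ((UnitaryGroup.LocalRing L v)ˣ × ↥(normOneUnits (conjLocal L (IsCMField.complexConj L) v))) => ((Units.map ((conjLocal L (IsCMField.complexConj L) v : UnitaryGroup.LocalRing L v →+* UnitaryGroup.LocalRing L v) : UnitaryGroup.LocalRing L v →* UnitaryGroup.LocalRing L v) p.1)⁻¹,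 p.2)) m))) :
    ∀ F : ((UnitaryGroup.LocalRing L v)ˣ × ↥(normOneUnits (conjLocal L (IsCMField.complexConj L) v))) → ℂ, IsLocSmooth F → (∀ m : ((UnitaryGroup.LocalRing L v)ˣ × ↥(normOneUnits (conjLocal L (IsCMField.complexConj L) v))), F ((fun p : ((UnitaryGroup.LocalRing L v)ˣ × ↥(normOneUnits (conjLocal L (IsCMField.complexConj L) v))) => ((Units.map ((conjLocal L (IsCMField.complexConj L) v : UnitaryGroup.LocalRing L v →+* UnitaryGroup.LocalRing L v) : UnitaryGroup.LocalRing L v →* UnitaryGroup.LocalRing L v) p.1)⁻¹, p.2)) m) = F m) → (∀ m ∈ (((Submonoid.pi Set.univ (fun w : PlacesOver L v => (w.1.adicCompletionIntegers L).toSubring.toSubmonoid)).units.prod (⊤ : Subgroup ↥(normOneUnits (conjLocal L (IsCMField.complexConj L) v)))) : Subgroup ((UnitaryGroup.LocalRing L v)ˣ × ↥(normOneUnits (conjLocal L (IsCMField.complexConj L) v)))), F m = 0) →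
      ∃ φ : Gqs L v → ℂ, (IsLocSmooth φ ∧ tsupport φ ⊆ Ω) ∧ F0P3cStCharTSTorusDefs.torusTransform L v mQv μM φ = F :=
  F0P3cStCharTSSurjHecke.surj_of_shells L v hns (F0P3cStCharTSTorusDefs.torusTransform L v mQv μM) (Ω) C hCo hCle hCb hshell
    (F0P3cStCharTSSurjHeckeLin.torusTransform_finset_sum L v hns νQv hcanQ μM)

/-- **(SHF′) AT THE NAMED TERMS MODULO THE SHELL TRANSFORMS**: (SURJ) above + ★ p849631 `shf_of_surj_torusTransform` — the (SHF′) conjunct of ★ p849458 with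
`Ftr := torusTransform L v mQv μM`, `Ω := hyperbolicSet L v`, `toC := pairChar L v`. [cite: Rogawski1990, §12.7 L. 12.7.1 (proof) p. 191; L. 12.7.2 (proof) pp. 193–194] -/
theorem shf_torusTransform_of_shells_on (hns : ∀ w : PlacesOver L v, IsCMField.complexConj L • w.1 = w.1) (Ω : Set (Gqs L v))
    [MeasurableSpace (Gqs L v)] [BorelSpace (Gqs L v)]
    [∀ γ : Gqs L v, MeasurableSpace (Gqs L v ⧸ Subgroup.centralizer ({γ} : Set (Gqs L v)))]
    [∀ γ : Gqs L v, BorelSpace (Gqs L v ⧸ Subgroup.centralizer ({γ} : Set (Gqs L v)))]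
    (νQv : Measure (Gqs L v)) [νQv.IsHaarMeasure] [νQv.IsMulRightInvariant]
    {mQv : OrbitalMeasureFamily (Gqs L v)} (hcanQ : mQv.IsCanonical (fun γ => IsRegularElt (γ.val : GL (Fin 3) (UnitaryGroup.LocalRing L v))) νQv)
    [MeasurableSpace ((UnitaryGroup.LocalRing L v)ˣ × ↥(normOneUnits (conjLocal L (IsCMField.complexConj L) v)))] (μM : Measure ((UnitaryGroup.LocalRing L v)ˣ × ↥(normOneUnits (conjLocal L (IsCMField.complexConj L) v))))
    (C : ℕ → Subgroup ((UnitaryGroup.LocalRing L v)ˣ × ↥(normOneUnits (conjLocal L (IsCMField.complexConj L) v)))) (hCo : ∀ n, IsOpen (C n : Set ((UnitaryGroup.LocalRing L v)ˣ × ↥(normOneUnits (conjLocal L (IsCMField.complexConj L) v)))))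
    (hCle : ∀ n, C n ≤ (((Submonoid.pi Set.univ (fun w : PlacesOver L v => (w.1.adicCompletionIntegers L).toSubring.toSubmonoid)).units.prod (⊤ : Subgroup ↥(normOneUnits (conjLocal L (IsCMField.complexConj L) v)))) : Subgroup ((UnitaryGroup.LocalRing L v)ˣ × ↥(normOneUnits (conjLocal L (IsCMField.complexConj L) v))))) (hCb : ∀ V ∈ 𝓝 (1 : ((UnitaryGroup.LocalRing L v)ˣ × ↥(normOneUnits (conjLocal L (IsCMField.complexConj L) v)))), ∃ n, (C n : Set ((UnitaryGroup.LocalRing L v)ˣ × ↥(normOneUnits (conjLocal L (IsCMField.complexConj L) v)))) ⊆ V)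
    (hshell : ∀ (n : ℕ) (u : ((UnitaryGroup.LocalRing L v)ˣ × ↥(normOneUnits (conjLocal L (IsCMField.complexConj L) v)))), (∀ w : PlacesOver L v, Valued.v ((u.1 : UnitaryGroup.LocalRing L v) w) < 1) →
      ∃ φ : Gqs L v → ℂ, IsLocSmooth φ ∧ tsupport φ ⊆ Ω ∧ ∃ κ : ℂ, κ ≠ 0 ∧
        F0P3cStCharTSTorusDefs.torusTransform L v mQv μM φ =
          fun m => κ * ((u • (C n : Set ((UnitaryGroup.LocalRing L v)ˣ × ↥(normOneUnits (conjLocal L (IsCMField.complexConj L) v))))).indicator (fun _ => (1 : ℂ)) m + (u • (C n : Set ((UnitaryGroup.LocalRing L v)ˣ × ↥(normOneUnits (conjLocal L (IsCMField.complexConj L) v))))).indicator (fun _ => (1 : ℂ)) ((fun p : ((UnitaryGroup.LocalRing L v)ˣ × ↥(normOneUnits (conjLocal L (IsCMField.complexConj L) v))) => ((Units.map ((conjLocal L (IsCMField.complexConj L) v : UnitaryGroup.LocalRing L v →+* UnitaryGroup.LocalRing L v) : UnitaryGroup.LocalRing L v →* UnitaryGroup.LocalRing L v) p.1)⁻¹,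 p.2)) m))) :
    (∀ χ : (((UnitaryGroup.LocalRing L v)ˣ →* ℂˣ) × (↥(normOneUnits (conjLocal L (IsCMField.complexConj L) v)) →* ℂˣ)), Continuous χ.1 → Continuous χ.2 → ∀ (j : Bool) (m₀ : ((UnitaryGroup.LocalRing L v)ˣ × ↥(normOneUnits (conjLocal L (IsCMField.complexConj L) v)))), m₀ ∉ ((Submonoid.pi Set.univ (fun w : PlacesOver L v => (w.1.adicCompletionIntegers L).toSubring.toSubmonoid)).units.prod (⊤ : Subgroup ↥(normOneUnits (conjLocal L (IsCMField.complexConj L) v)))) → ∃ φ : Gqs L v → ℂ, (IsLocSmooth φ ∧ tsupport φ ⊆ Ω) ∧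
            F0P3cStCharTSTorusDefs.torusTransform L v mQv μM φ = fun m => ((m₀ • ((((Submonoid.pi Set.univ (fun w : PlacesOver L v => (w.1.adicCompletionIntegers L).toSubring.toSubmonoid)).units.prod (⊤ : Subgroup ↥(normOneUnits (conjLocal L (IsCMField.complexConj L) v)))) : Subgroup ((UnitaryGroup.LocalRing L v)ˣ × ↥(normOneUnits (conjLocal L (IsCMField.complexConj L) v)))) : Set ((UnitaryGroup.LocalRing L v)ˣ × ↥(normOneUnits (conjLocal L (IsCMField.complexConj L) v))))).indicator (fun m => (((F0P3cStCharTSTorusDefs.pairChar L v (cond j (conjInvChar (conjLocal L (IsCMField.complexConj L) v) χ.1, χ.2) χ)) m₀ : ℂˣ) : ℂ) * ((((F0P3cStCharTSTorusDefs.pairChar L v (cond j (conjInvChar (conjLocal L (IsCMField.complexConj L) v) χ.1, χ.2) χ)) m)⁻¹ : ℂˣ) : ℂ)) m) + ((m₀ • ((((Submonoid.pi Set.univ (fun w : PlacesOver L v => (w.1.adicCompletionIntegers L).toSubring.toSubmonoid)).units.prod (⊤ : Subgroup ↥(normOneUnits (conjLocal L (IsCMField.complexConj L) v)))) : Subgroup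 ((UnitaryGroup.LocalRing L v)ˣ × ↥(normOneUnits (conjLocal L (IsCMField.complexConj L) v)))) : Set ((UnitaryGroup.LocalRing L v)ˣ × ↥(normOneUnits (conjLocal L (IsCMField.complexConj L) v))))).indicator (fun m => (((F0P3cStCharTSTorusDefs.pairChar L v (cond j (conjInvChar (conjLocal L (IsCMField.complexConj L) v) χ.1, χ.2) χ)) m₀ : ℂˣ) : ℂ) * ((((F0P3cStCharTSTorusDefs.pairChar L v (cond j (conjInvChar (conjLocal L (IsCMField.complexConj L) v) χ.1, χ.2) χ)) m)⁻¹ : ℂˣ) : ℂ)) ((Units.map ((conjLocal L (IsCMField.complexConj L) v : UnitaryGroup.LocalRing L v →+* UnitaryGroup.LocalRing L v) : UnitaryGroup.LocalRing L v →* UnitaryGroup.LocalRing L v) m.1)⁻¹, m.2))) :=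
  F0P3cStCharTSShfOfSurj.shf_of_surj L v hns (F0P3cStCharTSTorusDefs.torusTransform L v mQv μM) Ω (F0P3cStCharTSTorusDefs.pairChar L v)
    (F0P3cStCharTSTorusDefs.pairChar_apply L v) (surj_torusTransform_of_shells_on L v hns Ω νQv hcanQ μM C hCo hCle hCb hshell)

/-- **(SURJ) AT THE LEVELS OF AN IWAHORI DATUM, MODULO ONLY THE SHELL TRANSFORMS** — ★ p849718 `surj_torusTransform_of_shells` with `C n := ι⁻¹(M_T ∩ K_n)` and its three
properties discharged here. [cite: Rogawski1990, §12.7 L. 12.7.1 (proof) p. 191; L. 12.7.2 (proof) p. 194] -/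
theorem surj_torusTransform_of_levelShells_on (hns : ∀ w : PlacesOver L v, IsCMField.complexConj L • w.1 = w.1) (Ω : Set (Gqs L v))
    [MeasurableSpace (Gqs L v)] [BorelSpace (Gqs L v)]
    [∀ γ : Gqs L v, MeasurableSpace (Gqs L v ⧸ Subgroup.centralizer ({γ} : Set (Gqs L v)))]
    [∀ γ : Gqs L v, BorelSpace (Gqs L v ⧸ Subgroup.centralizer ({γ} : Set (Gqs L v)))]
    (νQv : Measure (Gqs L v)) [νQv.IsHaarMeasure] [νQv.IsMulRightInvariant]
    {mQv : OrbitalMeasureFamily (Gqs L v)} (hcanQ : mQv.IsCanonical (fun γ => IsRegularElt (γ.val : GL (Fin 3) (UnitaryGroup.LocalRing L v))) νQv)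
    [MeasurableSpace ((UnitaryGroup.LocalRing L v)ˣ × ↥(normOneUnits (conjLocal L (IsCMField.complexConj L) v)))] (μM : Measure ((UnitaryGroup.LocalRing L v)ˣ × ↥(normOneUnits (conjLocal L (IsCMField.complexConj L) v))))
    (𝓘 : (cmBorelTriple L 3 v).IwahoriDatum)
    (hK : ∀ n, ∀ k ∈ 𝓘.K n, k ∈ cmLocalIntegralLevel L 3 (Matrix.of fun i j : Fin 3 => if i.val + j.val + 1 = 3 then (1 : L) else 0) v)
    (hshell : ∀ (n : ℕ) (u : ((UnitaryGroup.LocalRing L v)ˣ × ↥(normOneUnits (conjLocal L (IsCMField.complexConj L) v)))), (∀ w : PlacesOver L v, Valued.v ((u.1 : UnitaryGroup.LocalRing L v) w) < 1) →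
      ∃ φ : Gqs L v → ℂ, IsLocSmooth φ ∧ tsupport φ ⊆ Ω ∧ ∃ κ : ℂ, κ ≠ 0 ∧
        F0P3cStCharTSTorusDefs.torusTransform L v mQv μM φ =
          fun m => κ * ((u • ((((𝓘.K n).subgroupOf (cmBorelTriple L 3 v).M).comap (F0P3cStCharTSTorusDefs.torusChartHom L v) : Subgroup ((UnitaryGroup.LocalRing L v)ˣ × ↥(normOneUnits (conjLocal L (IsCMField.complexConj L) v)))) : Set ((UnitaryGroup.LocalRing L v)ˣ × ↥(normOneUnits (conjLocal L (IsCMField.complexConj L) v))))).indicator (fun _ => (1 : ℂ)) m +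
            (u • ((((𝓘.K n).subgroupOf (cmBorelTriple L 3 v).M).comap (F0P3cStCharTSTorusDefs.torusChartHom L v) : Subgroup ((UnitaryGroup.LocalRing L v)ˣ × ↥(normOneUnits (conjLocal L (IsCMField.complexConj L) v)))) : Set ((UnitaryGroup.LocalRing L v)ˣ × ↥(normOneUnits (conjLocal L (IsCMField.complexConj L) v))))).indicator (fun _ => (1 : ℂ)) ((fun p : ((UnitaryGroup.LocalRing L v)ˣ × ↥(normOneUnits (conjLocal L (IsCMField.complexConj L) v))) => ((Units.map ((conjLocal L (IsCMField.complexConj L) v : UnitaryGroup.LocalRing L v →+* UnitaryGroup.LocalRing L v) : UnitaryGroup.LocalRing L v →* UnitaryGroup.LocalRing L v) p.1)⁻¹, p.2)) m))) :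
    ∀ F : ((UnitaryGroup.LocalRing L v)ˣ × ↥(normOneUnits (conjLocal L (IsCMField.complexConj L) v))) → ℂ, IsLocSmooth F → (∀ m : ((UnitaryGroup.LocalRing L v)ˣ × ↥(normOneUnits (conjLocal L (IsCMField.complexConj L) v))), F ((fun p : ((UnitaryGroup.LocalRing L v)ˣ × ↥(normOneUnits (conjLocal L (IsCMField.complexConj L) v))) => ((Units.map ((conjLocal L (IsCMField.complexConj L) v : UnitaryGroup.LocalRing L v →+* UnitaryGroup.LocalRing L v) : UnitaryGroup.LocalRing L v →* UnitaryGroup.LocalRing L v) p.1)⁻¹, p.2)) m) = F m) → (∀ m ∈ (((Submonoid.pi Set.univ (fun w : PlacesOver L v => (w.1.adicCompletionIntegers L).toSubring.toSubmonoid)).units.prod (⊤ : Subgroup ↥(normOneUnits (conjLocal L (IsCMField.complexConj L) v)))) : Subgroup ((UnitaryGroup.LocalRing L v)ˣ × ↥(normOneUnits (conjLocal L (IsCMField.complexConj L) v)))), F m = 0) →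
      ∃ φ : Gqs L v → ℂ, (IsLocSmooth φ ∧ tsupport φ ⊆ Ω) ∧ F0P3cStCharTSTorusDefs.torusTransform L v mQv μM φ = F :=
  surj_torusTransform_of_shells_on L v hns Ω νQv hcanQ μM
    (fun n => ((𝓘.K n).subgroupOf (cmBorelTriple L 3 v).M).comap (F0P3cStCharTSTorusDefs.torusChartHom L v))
    (F0P3cStCharTSLevelFamily.isOpen_levelFamily L v 𝓘) (F0P3cStCharTSLevelFamily.levelFamily_le_torusCompactPart L v hns 𝓘 hK)
    (F0P3cStCharTSLevelFamily.levelFamily_basis L v 𝓘) hshell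

/-- **(SHF′) AT THE LEVELS OF AN IWAHORI DATUM, MODULO ONLY THE SHELL TRANSFORMS** — the (SHF′) conjunct of ★ p849458 at `torusTransform`∕`hyperbolicSet`∕`pairChar`, from
★ p849718 `shf_torusTransform_of_shells` with the level family `C n := ι⁻¹(M_T ∩ K_n)` discharged here; what remains is `hshell` (road (D) D3-ii-G ★ p849606 + its
Ψ-producer + F1-G ★ `F0P3cStCharTSShellTracePS`, at the levels of `𝓘`) and «`K_n ⊆ K_v`». [cite: Rogawski1990, §12.7 L. 12.7.1 (proof) p. 191; L. 12.7.2 (proof) pp. 193–194] -/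
theorem shf_torusTransform_of_levelShells_on (hns : ∀ w : PlacesOver L v, IsCMField.complexConj L • w.1 = w.1) (Ω : Set (Gqs L v))
    [MeasurableSpace (Gqs L v)] [BorelSpace (Gqs L v)]
    [∀ γ : Gqs L v, MeasurableSpace (Gqs L v ⧸ Subgroup.centralizer ({γ} : Set (Gqs L v)))]
    [∀ γ : Gqs L v, BorelSpace (Gqs L v ⧸ Subgroup.centralizer ({γ} : Set (Gqs L v)))]
    (νQv : Measure (Gqs L v)) [νQv.IsHaarMeasure] [νQv.IsMulRightInvariant]
    {mQv : OrbitalMeasureFamily (Gqs L v)} (hcanQ : mQv.IsCanonical (fun γ => IsRegularElt (γ.val : GL (Fin 3) (UnitaryGroup.LocalRing L v))) νQv)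
    [MeasurableSpace ((UnitaryGroup.LocalRing L v)ˣ × ↥(normOneUnits (conjLocal L (IsCMField.complexConj L) v)))] (μM : Measure ((UnitaryGroup.LocalRing L v)ˣ × ↥(normOneUnits (conjLocal L (IsCMField.complexConj L) v))))
    (𝓘 : (cmBorelTriple L 3 v).IwahoriDatum)
    (hK : ∀ n, ∀ k ∈ 𝓘.K n, k ∈ cmLocalIntegralLevel L 3 (Matrix.of fun i j : Fin 3 => if i.val + j.val + 1 = 3 then (1 : L) else 0) v)
    (hshell : ∀ (n : ℕ) (u : ((UnitaryGroup.LocalRing L v)ˣ × ↥(normOneUnits (conjLocal L (IsCMField.complexConj L) v)))), (∀ w : PlacesOver L v, Valued.v ((u.1 : UnitaryGroup.LocalRing L v) w) < 1) →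
      ∃ φ : Gqs L v → ℂ, IsLocSmooth φ ∧ tsupport φ ⊆ Ω ∧ ∃ κ : ℂ, κ ≠ 0 ∧
        F0P3cStCharTSTorusDefs.torusTransform L v mQv μM φ =
          fun m => κ * ((u • ((((𝓘.K n).subgroupOf (cmBorelTriple L 3 v).M).comap (F0P3cStCharTSTorusDefs.torusChartHom L v) : Subgroup ((UnitaryGroup.LocalRing L v)ˣ × ↥(normOneUnits (conjLocal L (IsCMField.complexConj L) v)))) : Set ((UnitaryGroup.LocalRing L v)ˣ × ↥(normOneUnits (conjLocal L (IsCMField.complexConj L) v))))).indicator (fun _ => (1 : ℂ)) m +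
            (u • ((((𝓘.K n).subgroupOf (cmBorelTriple L 3 v).M).comap (F0P3cStCharTSTorusDefs.torusChartHom L v) : Subgroup ((UnitaryGroup.LocalRing L v)ˣ × ↥(normOneUnits (conjLocal L (IsCMField.complexConj L) v)))) : Set ((UnitaryGroup.LocalRing L v)ˣ × ↥(normOneUnits (conjLocal L (IsCMField.complexConj L) v))))).indicator (fun _ => (1 : ℂ)) ((fun p : ((UnitaryGroup.LocalRing L v)ˣ × ↥(normOneUnits (conjLocal L (IsCMField.complexConj L) v))) => ((Units.map ((conjLocal L (IsCMField.complexConj L) v : UnitaryGroup.LocalRing L v →+* UnitaryGroup.LocalRing L v) : UnitaryGroup.LocalRing L v →* UnitaryGroup.LocalRing L v) p.1)⁻¹, p.2)) m))) :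
    (∀ χ : (((UnitaryGroup.LocalRing L v)ˣ →* ℂˣ) × (↥(normOneUnits (conjLocal L (IsCMField.complexConj L) v)) →* ℂˣ)), Continuous χ.1 → Continuous χ.2 → ∀ (j : Bool) (m₀ : ((UnitaryGroup.LocalRing L v)ˣ × ↥(normOneUnits (conjLocal L (IsCMField.complexConj L) v)))), m₀ ∉ ((Submonoid.pi Set.univ (fun w : PlacesOver L v => (w.1.adicCompletionIntegers L).toSubring.toSubmonoid)).units.prod (⊤ : Subgroup ↥(normOneUnits (conjLocal L (IsCMField.complexConj L) v)))) → ∃ φ : Gqs L v → ℂ, (IsLocSmooth φ ∧ tsupport φ ⊆ Ω) ∧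
            F0P3cStCharTSTorusDefs.torusTransform L v mQv μM φ = fun m => ((m₀ • ((((Submonoid.pi Set.univ (fun w : PlacesOver L v => (w.1.adicCompletionIntegers L).toSubring.toSubmonoid)).units.prod (⊤ : Subgroup ↥(normOneUnits (conjLocal L (IsCMField.complexConj L) v)))) : Subgroup ((UnitaryGroup.LocalRing L v)ˣ × ↥(normOneUnits (conjLocal L (IsCMField.complexConj L) v)))) : Set ((UnitaryGroup.LocalRing L v)ˣ × ↥(normOneUnits (conjLocal L (IsCMField.complexConj L) v))))).indicator (fun m => (((F0P3cStCharTSTorusDefs.pairChar L v (cond j (conjInvChar (conjLocal L (IsCMField.complexConj L) v) χ.1, χ.2) χ)) m₀ : ℂˣ) : ℂ) * ((((F0P3cStCharTSTorusDefs.pairChar L v (cond j (conjInvChar (conjLocal L (IsCMField.complexConj L) v) χ.1, χ.2) χ)) m)⁻¹ : ℂˣ) : ℂ)) m) + ((m₀ • ((((Submonoid.pi Set.univ (fun w : PlacesOver L v => (w.1.adicCompletionIntegers L).toSubring.toSubmonoid)).units.prod (⊤ : Subgroup ↥(normOneUnits (conjLocal L (IsCMField.complexConj L) v)))) : Subgroup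 ((UnitaryGroup.LocalRing L v)ˣ × ↥(normOneUnits (conjLocal L (IsCMField.complexConj L) v)))) : Set ((UnitaryGroup.LocalRing L v)ˣ × ↥(normOneUnits (conjLocal L (IsCMField.complexConj L) v))))).indicator (fun m => (((F0P3cStCharTSTorusDefs.pairChar L v (cond j (conjInvChar (conjLocal L (IsCMField.complexConj L) v) χ.1, χ.2) χ)) m₀ : ℂˣ) : ℂ) * ((((F0P3cStCharTSTorusDefs.pairChar L v (cond j (conjInvChar (conjLocal L (IsCMField.complexConj L) v) χ.1, χ.2) χ)) m)⁻¹ : ℂˣ) : ℂ)) ((Units.map ((conjLocal L (IsCMField.complexConj L) v : UnitaryGroup.LocalRing L v →+* UnitaryGroup.LocalRing L v) : UnitaryGroup.LocalRing L v →* UnitaryGroup.LocalRing L v) m.1)⁻¹, m.2))) :=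
  shf_torusTransform_of_shells_on L v hns Ω νQv hcanQ μM
    (fun n => ((𝓘.K n).subgroupOf (cmBorelTriple L 3 v).M).comap (F0P3cStCharTSTorusDefs.torusChartHom L v))
    (F0P3cStCharTSLevelFamily.isOpen_levelFamily L v 𝓘) (F0P3cStCharTSLevelFamily.levelFamily_le_torusCompactPart L v hns 𝓘 hK)
    (F0P3cStCharTSLevelFamily.levelFamily_basis L v 𝓘) hshell

/-- **«HSHELL-GLUE★» — the `hshell` clause of ★ p849718 ∕ p849745 at `(n, u)` from a two-coset identity.**  Given a smooth `φ` supported in `hyperbolicSet` (e.g. `𝟙_{K_n ι(u) K_n}`,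
★ HYP-SET p849676) whose normalised canonical orbital integrals along `M_T` satisfy the two-coset identity with `κ_T ≠ 0` (road (D): ★ p849606 + Ψ-producer + F1-G +
«SHELL-WEIGHT★»), the shell clause holds with `C = ι⁻¹(C_T)` and `κ = (2 μM(M_c))⁻¹ κ_T`. [cite: Rogawski1990, §12.7 L. 12.7.1 (proof) p. 191; L. 12.7.2 (proof) pp. 193–194] -/
theorem hshell_of_twoCoset_on (hns : ∀ w : PlacesOver L v, IsCMField.complexConj L • w.1 = w.1) (Ω : Set (Gqs L v))
    [MeasurableSpace (Gqs L v)] [∀ γ : Gqs L v, MeasurableSpace (Gqs L v ⧸ Subgroup.centralizer ({γ} : Set (Gqs L v)))]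
    (mQv : OrbitalMeasureFamily (Gqs L v)) [MeasurableSpace ((UnitaryGroup.LocalRing L v)ˣ × ↥(normOneUnits (conjLocal L (IsCMField.complexConj L) v)))] [BorelSpace ((UnitaryGroup.LocalRing L v)ˣ × ↥(normOneUnits (conjLocal L (IsCMField.complexConj L) v)))] (μM : Measure ((UnitaryGroup.LocalRing L v)ˣ × ↥(normOneUnits (conjLocal L (IsCMField.complexConj L) v)))) [μM.IsHaarMeasure]
    (CT : Subgroup ↥(cmBorelTriple L 3 v).M)
    (hCω : ∀ x : ((UnitaryGroup.LocalRing L v)ˣ × ↥(normOneUnits (conjLocal L (IsCMField.complexConj L) v))), F0P3cStCharTSTorusDefs.torusChart L v x ∈ CT → F0P3cStCharTSTorusDefs.torusChart L v ((fun p : ((UnitaryGroup.LocalRing L v)ˣ × ↥(normOneUnits (conjLocal L (IsCMField.complexConj L) v))) => ((Units.map ((conjLocal L (IsCMField.complexConj L) v : UnitaryGroup.LocalRing L v →+* UnitaryGroup.LocalRing L v) : UnitaryGroup.LocalRing L v →* UnitaryGroup.LocalRing L v) p.1)⁻¹, p.2)) x) ∈ CT)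
    (u : ((UnitaryGroup.LocalRing L v)ˣ × ↥(normOneUnits (conjLocal L (IsCMField.complexConj L) v)))) (φ : Gqs L v → ℂ) (hφ : IsLocSmooth φ) (hφΩ : tsupport φ ⊆ Ω) (κT : ℂ) (hκT : κT ≠ 0)
    (htwo : ∀ t : ↥(cmBorelTriple L 3 v).M,
      F0P3cStCharTSTorusDefs.vanDijkWeight L v t *
          classOrbitalIntegral mQv φ (ConjClasses.mk (((t : ↥(cmBorelTriple L 3 v).M) :
            ↥(unitaryGroupOfForm (conjLocal L (IsCMField.complexConj L) v) (cmLocalForm L 3 v))) : Gqs L v)) =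
        κT * ({t' : ↥(cmBorelTriple L 3 v).M | (F0P3cStCharTSTorusDefs.torusChart L v u)⁻¹ * t' ∈ (CT : Set ↥(cmBorelTriple L 3 v).M)}.indicator (fun _ => (1 : ℂ)) t +
          {t' : ↥(cmBorelTriple L 3 v).M | (F0P3cStCharTSTorusDefs.torusChart L v ((fun p : ((UnitaryGroup.LocalRing L v)ˣ × ↥(normOneUnits (conjLocal L (IsCMField.complexConj L) v))) => ((Units.map ((conjLocal L (IsCMField.complexConj L) v : UnitaryGroup.LocalRing L v →+* UnitaryGroup.LocalRing L v) : UnitaryGroup.LocalRing L v →* UnitaryGroup.LocalRing L v) p.1)⁻¹, p.2)) u))⁻¹ * t' ∈ (CT : Set ↥(cmBorelTriple L 3 v).M)}.indicator (fun _ => (1 : ℂ)) t)) :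
    ∃ φ' : Gqs L v → ℂ, IsLocSmooth φ' ∧ tsupport φ' ⊆ Ω ∧ ∃ κ : ℂ, κ ≠ 0 ∧
      F0P3cStCharTSTorusDefs.torusTransform L v mQv μM φ' =
        fun m => κ * ((u • ((CT.comap (F0P3cStCharTSTorusDefs.torusChartHom L v) : Subgroup ((UnitaryGroup.LocalRing L v)ˣ × ↥(normOneUnits (conjLocal L (IsCMField.complexConj L) v)))) : Set ((UnitaryGroup.LocalRing L v)ˣ × ↥(normOneUnits (conjLocal L (IsCMField.complexConj L) v))))).indicator (fun _ => (1 : ℂ)) m +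
          (u • ((CT.comap (F0P3cStCharTSTorusDefs.torusChartHom L v) : Subgroup ((UnitaryGroup.LocalRing L v)ˣ × ↥(normOneUnits (conjLocal L (IsCMField.complexConj L) v)))) : Set ((UnitaryGroup.LocalRing L v)ˣ × ↥(normOneUnits (conjLocal L (IsCMField.complexConj L) v))))).indicator (fun _ => (1 : ℂ)) ((fun p : ((UnitaryGroup.LocalRing L v)ˣ × ↥(normOneUnits (conjLocal L (IsCMField.complexConj L) v))) => ((Units.map ((conjLocal L (IsCMField.complexConj L) v : UnitaryGroup.LocalRing L v →+* UnitaryGroup.LocalRing L v) : UnitaryGroup.LocalRing L v →* UnitaryGroup.LocalRing L v) p.1)⁻¹, p.2)) m)) :=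
  ⟨φ, hφ, hφΩ, _, mul_ne_zero (F0P3cStCharTSHShellGlue.inv_two_mul_measureReal_torusCompactPart_ne_zero L v hns μM) hκT,
    F0P3cStCharTSHShellGlue.torusTransform_eq_of_twoCoset L v mQv μM CT hCω u φ κT htwo⟩

/-- **`hshell` FROM THE PRODUCER `Ψ`** — `htwo_of_psi` composed with ★ p849770 `hshell_of_twoCoset`: the `hshell` clause of ★ p849745 `shf_torusTransform_of_levelShells`
at `(n, u)` with `C_T := (𝓘.K n).subgroupOf M_T`. [cite: Rogawski1990, §12.7 L. 12.7.1 (proof) p. 191; L. 12.7.2 (proof) pp. 193–194] -/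
theorem hshell_of_psi_on (hns : ∀ w : PlacesOver L v, IsCMField.complexConj L • w.1 = w.1) (Ω : Set (Gqs L v))
    [MeasurableSpace (Gqs L v)] [∀ γ : Gqs L v, MeasurableSpace (Gqs L v ⧸ Subgroup.centralizer ({γ} : Set (Gqs L v)))]
    (mQv : OrbitalMeasureFamily (Gqs L v)) [MeasurableSpace ((UnitaryGroup.LocalRing L v)ˣ × ↥(normOneUnits (conjLocal L (IsCMField.complexConj L) v)))] [BorelSpace ((UnitaryGroup.LocalRing L v)ˣ × ↥(normOneUnits (conjLocal L (IsCMField.complexConj L) v)))] (μM : Measure ((UnitaryGroup.LocalRing L v)ˣ × ↥(normOneUnits (conjLocal L (IsCMField.complexConj L) v)))) [μM.IsHaarMeasure]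
    (CT : Subgroup ↥(cmBorelTriple L 3 v).M) (hCle : (CT.comap (F0P3cStCharTSTorusDefs.torusChartHom L v) : Subgroup ((UnitaryGroup.LocalRing L v)ˣ × ↥(normOneUnits (conjLocal L (IsCMField.complexConj L) v)))) ≤ (((Submonoid.pi Set.univ (fun w : PlacesOver L v => (w.1.adicCompletionIntegers L).toSubring.toSubmonoid)).units.prod (⊤ : Subgroup ↥(normOneUnits (conjLocal L (IsCMField.complexConj L) v)))) : Subgroup ((UnitaryGroup.LocalRing L v)ˣ × ↥(normOneUnits (conjLocal L (IsCMField.complexConj L) v)))))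
    (hCω : ∀ x : ((UnitaryGroup.LocalRing L v)ˣ × ↥(normOneUnits (conjLocal L (IsCMField.complexConj L) v))), F0P3cStCharTSTorusDefs.torusChart L v x ∈ CT → F0P3cStCharTSTorusDefs.torusChart L v ((fun p : ((UnitaryGroup.LocalRing L v)ˣ × ↥(normOneUnits (conjLocal L (IsCMField.complexConj L) v))) => ((Units.map ((conjLocal L (IsCMField.complexConj L) v : UnitaryGroup.LocalRing L v →+* UnitaryGroup.LocalRing L v) : UnitaryGroup.LocalRing L v →* UnitaryGroup.LocalRing L v) p.1)⁻¹, p.2)) x) ∈ CT)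
    (u : ((UnitaryGroup.LocalRing L v)ˣ × ↥(normOneUnits (conjLocal L (IsCMField.complexConj L) v)))) (hu : u ∉ (((Submonoid.pi Set.univ (fun w : PlacesOver L v => (w.1.adicCompletionIntegers L).toSubring.toSubmonoid)).units.prod (⊤ : Subgroup ↥(normOneUnits (conjLocal L (IsCMField.complexConj L) v)))) : Subgroup ((UnitaryGroup.LocalRing L v)ˣ × ↥(normOneUnits (conjLocal L (IsCMField.complexConj L) v))))) (φ : Gqs L v → ℂ) (hφ : IsLocSmooth φ) (hφΩ : tsupport φ ⊆ Ω)
    (Ψ : ↥(cmBorelTriple L 3 v).M → ℂ) (κ : ℂ) (hκ : κ ≠ 0)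
    (hΨpt : haveI := locallyCompactSpace_cmBorelU L 3 v
      ∀ (t : ↥(cmBorelTriple L 3 v).M) (d : Fin 3 → (LocalRing L v)ˣ)
      (hd : glDiagonal 3 (LocalRing L v) d =
        ((t : ↥(unitaryGroupOfForm (conjLocal L (IsCMField.complexConj L) v) (cmLocalForm L 3 v))) : GL (Fin 3) (LocalRing L v)))
      (ha' : IsUnit ((((d 0)⁻¹ * d 1 : (LocalRing L v)ˣ) : LocalRing L v) - 1))
      (hb' : IsUnit ((((d 0)⁻¹ * d 2 : (LocalRing L v)ˣ) : LocalRing L v) - 1)),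
      Ψ t =
          ((rootDeltaChar (cmBorelTriple L 3 v).P
            ⟨(t : ↥(unitaryGroupOfForm (conjLocal L (IsCMField.complexConj L) v) (cmLocalForm L 3 v))), (cmBorelTriple L 3 v).M_le t.2⟩ : ℂˣ) : ℂ) *
        (((letI : MeasurableSpace (LocalRing L v) := borel _; haveI : BorelSpace (LocalRing L v) := ⟨rfl⟩
          haveI : SecondCountableTopology (LocalRing L v) := secondCountableTopology_localRing (E := L) v
          ((distribHaarChar (LocalRing L v) ha'.unit)⁻¹ *
            (HeisRing.skewModulus (conjLocal L (IsCMField.complexConj L) v) (continuous_conjLocal L (IsCMField.complexConj L) v) hb'.unit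
              (HeisRing.map_unit_torusCentralScalar_sub_one (conjLocal L (IsCMField.complexConj L) v) (cmLocalForm_eq_over L 3 v) t hd hb'))⁻¹ :
                ℝ≥0)) : ℝ) : ℂ)⁻¹ *
        classOrbitalIntegral mQv φ
          (ConjClasses.mk ((t : ↥(unitaryGroupOfForm (conjLocal L (IsCMField.complexConj L) v) (cmLocalForm L 3 v))) : Gqs L v)))
    (hΨtwo : Ψ = fun t => κ * ({t' : ↥(cmBorelTriple L 3 v).M | (F0P3cStCharTSTorusDefs.torusChart L v u)⁻¹ * t' ∈ (CT : Set ↥(cmBorelTriple L 3 v).M)}.indicator (fun _ => (1 : ℂ)) t +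
        {t' : ↥(cmBorelTriple L 3 v).M | (F0P3cStCharTSTorusDefs.torusChart L v ((fun p : ((UnitaryGroup.LocalRing L v)ˣ × ↥(normOneUnits (conjLocal L (IsCMField.complexConj L) v))) => ((Units.map ((conjLocal L (IsCMField.complexConj L) v : UnitaryGroup.LocalRing L v →+* UnitaryGroup.LocalRing L v) : UnitaryGroup.LocalRing L v →* UnitaryGroup.LocalRing L v) p.1)⁻¹, p.2)) u))⁻¹ * t' ∈ (CT : Set ↥(cmBorelTriple L 3 v).M)}.indicator (fun _ => (1 : ℂ)) t)) :
    ∃ φ' : Gqs L v → ℂ, IsLocSmooth φ' ∧ tsupport φ' ⊆ Ω ∧ ∃ κ' : ℂ, κ' ≠ 0 ∧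
      F0P3cStCharTSTorusDefs.torusTransform L v mQv μM φ' =
        fun m => κ' * ((u • ((CT.comap (F0P3cStCharTSTorusDefs.torusChartHom L v) : Subgroup ((UnitaryGroup.LocalRing L v)ˣ × ↥(normOneUnits (conjLocal L (IsCMField.complexConj L) v)))) : Set ((UnitaryGroup.LocalRing L v)ˣ × ↥(normOneUnits (conjLocal L (IsCMField.complexConj L) v))))).indicator (fun _ => (1 : ℂ)) m +
          (u • ((CT.comap (F0P3cStCharTSTorusDefs.torusChartHom L v) : Subgroup ((UnitaryGroup.LocalRing L v)ˣ × ↥(normOneUnits (conjLocal L (IsCMField.complexConj L) v)))) : Set ((UnitaryGroup.LocalRing L v)ˣ × ↥(normOneUnits (conjLocal L (IsCMField.complexConj L) v))))).indicator (fun _ => (1 : ℂ)) ((fun p : ((UnitaryGroup.LocalRing L v)ˣ × ↥(normOneUnits (conjLocal L (IsCMField.complexConj L) v))) => ((Units.map ((conjLocal L (IsCMField.complexConj L) v : UnitaryGroup.LocalRing L v →+* UnitaryGroup.LocalRing L v) : UnitaryGroup.LocalRing L v →* UnitaryGroup.LocalRing L v) p.1)⁻¹, p.2)) m)) :=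
  hshell_of_twoCoset_on L v hns Ω mQv μM CT hCω u φ hφ hφΩ κ hκ
    (F0P3cStCharTSHTwoOfPsi.htwo_of_psi L v hns mQv CT hCle u hu φ Ψ κ hΨpt hΨtwo)

end Summit.HodgeConjecture.HodgeConjecture.Cruxes.H413.F0P3cStCharTSSurjOmega

end
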